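import Summits.AnomalousDissipation.AnomalousDissipation.Theorems.BaireTransferRobustLoudUpgradeStubSteadyStratumClosed
import Summits.AnomalousDissipation.AnomalousDissipation.Theorems.BaireTransferRobustLoudUpgradeStubFsigmaMeagre

/-!
# The category of the steady leaf of the crux `BaireTransfer.RobustLoudUpgrade` (stmt-AnomalousDissipation-1144):
# the mean-zero steady-loud set is `F_σ`, so the steady leaf of the upgrade fails at most on a MEAGRE set

Lead c15 of the line `malkin-cone-group-orbits` (category package; assembly of the registered stubs
`stub_steadyStratumClosed` — `…StubSteadyStratumClosed`, and `stub_fsigma_meagre` — `…StubFsigmaMeagre`).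

* `loudSteadyLeaf S a E ε` — coefficient vectors `c ∈ P_S` carrying, at some `ν ∈ (0,a)`, a MEAN-ZERO classical steady state of
  `NS_ν(f_c)` with `meanEnergy ≤ E`, `meanDissipation ≥ ε` (the conserved-mean leaf of the steady witnesses of `loud S a E ε`);
  `steadyStratum S a E ε n` — the same with `ν` confined to the slab `[1/(n+1), a − 1/(n+1)]`.
* `isClosed_steadyStratum`, `loudSteadyLeaf_eq_iUnion`: the leaf is a countable union of CLOSED strata (`F_σ`).
* `isMeagre_loudSteadyLeaf_diff_interior_loud`: **for every `S, a, E, ε` the mean-zero steady-loud forces that are not INTERIOR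
  points of `loud S a E ε` — same budgets, no stock — form a MEAGRE subset of `P_S`**; a fortiori (`isMeagre_steadyLeaf_residual`)
  the steady leaf of the crux's wild residual `loud(E,ε) ∖ closure (interior loud(2E,ε/2))` is meagre.  This is the category form of
  the strategist census's codimension diagnosis W1 ("wild configurations are coincidences of expected codimension −1") and of the
  remarks NOTES-c4 §2 / Lines/malkin-cone-group-orbits-dead-c12 §3, now kernel-checked for steady witnesses of zero mean.
* `interior_loud_nonempty_or_isMeagre`: the DICHOTOMY near any force — in every open `V ⊆ P_S` either robustly loud forces exist or
  the mean-zero steady-loud forces of `V` are meagre; there is no third option (dense-but-fragile steady loudness is meagre loudness).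
* `baireTarget_of_nonmeagre_steadyLeaf`: a typed ROUTE-LEVEL DOOR without the upgrade crux — the route target `BaireTarget` follows
  from LOCALLY NON-MEAGRE mean-zero steady loudness in some open `U` at every level (compare `WildResidual.baireTarget_of_dense_tame`).

What is NOT claimed: nothing here shrinks the registered residual `Poly.stub_residual_c14` (≡ the crux); steady witnesses of
non-zero mean and genuinely time-periodic witnesses are not covered (the former needs the drifted weak formulation, the latter a
parabolic compactness theorem for `H¹`-bounded periodic classical solutions, neither in the tree).

References: Oxtoby, *Measure and Category* (1980) Ch. 9 (Baire category, `F_σ` sets); Temam, *Navier–Stokes Equations* (1979) Ch. II §1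
(steady states: existence, regularity, compactness); the route file `Theses/BaireTransfer.lean` (items 1143–1145);
`Cruxes/RobustLoudUpgrade/STRATEGY-CENSUS.md` (W1, R1–R4).
-/

-- `Summit.<Summit>.<Problem>` is the tree's mandated summit-side namespace (CONVENTIONS §2); for this
-- single-conjunct summit the two coincide, so the duplicate is deliberate.
set_option linter.dupNamespace false

noncomputable section

open scoped Topology
open Filter Set Function TopologicalSpace MeasureTheory

namespace Summit.AnomalousDissipation.AnomalousDissipation.Theorems.RobustLoudUpgrade.Category

open Literature.Analysis.FunctionSpaces Literature.Analysis.FunctionSpaces.Torus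
open Literature.Analysis.FluidPDE
open Summit.AnomalousDissipation.AnomalousDissipation.Theses.BaireTransfer

/-- The flat unit torus `T³`. -/
local notation "𝕋³" => UnitAddTorus (Fin 3)
/-- Real velocity values. -/
local notation "ℝ³" => EuclideanSpace ℝ (Fin 3)

/-! ## §1 The mean-zero steady-loud set and its closed strata -/

/-- The MEAN-ZERO STEADY-LOUD set `loudSteadyLeaf S a E ε`: coefficient vectors carrying, at some `ν ∈ (0,a)`, a mean-zero
classical steady state of `NS_ν(f_c)` with `meanEnergy ≤ E` and `meanDissipation ≥ ε` (the conserved-mean leaf of the steady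
witnesses of `loud S a E ε`). [folklore] -/
def loudSteadyLeaf (S : Finset (Fin 3 → ℤ)) (a E ε : ℝ) : Set (Coeff S) :=
  {c | ∃ ν : ℝ, 0 < ν ∧ ν < a ∧ ∃ (u : 𝕋³ → ℝ³) (p : 𝕋³ → ℝ),
    Torus.IsSteadyNSState ν (force S c) u p ∧ HasZeroMean u ∧
      meanEnergy (fun _ : ℝ => u) ≤ E ∧ ε ≤ meanDissipation ν (fun _ : ℝ => u)}

/-- The strata of `loudSteadyLeaf`: the viscosity of the witness confined to the compact slab `[1/(n+1), a − 1/(n+1)]`. [folklore] -/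
def steadyStratum (S : Finset (Fin 3 → ℤ)) (a E ε : ℝ) (n : ℕ) : Set (Coeff S) :=
  {c | ∃ ν : ℝ, 1 / ((n : ℝ) + 1) ≤ ν ∧ ν ≤ a - 1 / ((n : ℝ) + 1) ∧ ∃ (u : 𝕋³ → ℝ³) (p : 𝕋³ → ℝ),
    Torus.IsSteadyNSState ν (force S c) u p ∧ HasZeroMean u ∧
      meanEnergy (fun _ : ℝ => u) ≤ E ∧ ε ≤ meanDissipation ν (fun _ : ℝ => u)}

/-- **Each stratum is closed** (the registered stub `stub_steadyStratumClosed`: Rellich compactness of steady states with viscosity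
in a compact slab). [folklore] -/
theorem isClosed_steadyStratum (S : Finset (Fin 3 → ℤ)) (a E ε : ℝ) (n : ℕ) :
    IsClosed (steadyStratum S a E ε n) :=
  stub_steadyStratumClosed S (1 / ((n : ℝ) + 1)) (a - 1 / ((n : ℝ) + 1)) E ε (by positivity)

/-- **The mean-zero steady-loud set is `F_σ`**: it is the union of its closed strata (every `ν ∈ (0,a)` lies in some slab). [folklore] -/
theorem loudSteadyLeaf_eq_iUnion (S : Finset (Fin 3 → ℤ)) (a E ε : ℝ) :
    loudSteadyLeaf S a E ε = ⋃ n, steadyStratum S a E ε n := by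
  ext c
  simp only [loudSteadyLeaf, steadyStratum, mem_setOf_eq, mem_iUnion]
  constructor
  · rintro ⟨ν, hν, hνa, u, p, hst, h0, hE, hε⟩
    obtain ⟨n, hn⟩ := exists_nat_gt (1 / min ν (a - ν))
    have hmin : 0 < min ν (a - ν) := lt_min hν (by linarith)
    have hn1 : 1 / ((n : ℝ) + 1) ≤ min ν (a - ν) := by
      rw [div_le_iff₀ (by positivity)]
      have h1 : 1 / min ν (a - ν) * min ν (a - ν) = 1 := by field_simp
      nlinarith [hmin, hn, h1]
    refine ⟨n, ν, hn1.trans (min_le_left _ _), ?_, u, p, hst, h0, hE, hε⟩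
    have := hn1.trans (min_le_right _ _)
    linarith
  · rintro ⟨n, ν, hν, hνa, u, p, hst, h0, hE, hε⟩
    have hpos : (0 : ℝ) < 1 / ((n : ℝ) + 1) := by positivity
    exact ⟨ν, hpos.trans_le hν, by linarith, u, p, hst, h0, hE, hε⟩

/-- Mean-zero steady witnesses are loud witnesses (`1`-periodic in time). [folklore] -/
theorem loudSteadyLeaf_subset_loud (S : Finset (Fin 3 → ℤ)) (a E ε : ℝ) :
    loudSteadyLeaf S a E ε ⊆ loud S a E ε := by
  rintro c ⟨ν, hν, hνa, u, p, hst, -, hE, hε⟩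
  exact ⟨ν, hν, hνa, 1, fun _ => u, fun _ => p, one_pos, hst, fun _ => rfl, hE, hε⟩

/-- `loud` is monotone in the budgets. [folklore] -/
theorem loud_mono {S : Finset (Fin 3 → ℤ)} {a E E' ε ε' : ℝ} (hE : E ≤ E') (hε : ε' ≤ ε) :
    loud S a E ε ⊆ loud S a E' ε' := by
  rintro c ⟨ν, hν, hνa, τ, u, p, hτ, hsol, hper, h1, h2⟩
  exact ⟨ν, hν, hνa, τ, u, p, hτ, hsol, hper, h1.trans hE, hε.trans h2⟩

/-- `loudSteadyLeaf` is monotone in the budgets. [folklore] -/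
theorem loudSteadyLeaf_mono {S : Finset (Fin 3 → ℤ)} {a E E' ε ε' : ℝ} (hE : E ≤ E') (hε : ε' ≤ ε) :
    loudSteadyLeaf S a E ε ⊆ loudSteadyLeaf S a E' ε' := by
  rintro c ⟨ν, hν, hνa, u, p, hst, h0, h1, h2⟩
  exact ⟨ν, hν, hνa, u, p, hst, h0, h1.trans hE, hε.trans h2⟩

/-! ## §2 The steady leaf of the upgrade fails at most on a meagre set -/

/-- The non-interior part of the `F_σ` set `loudSteadyLeaf` is meagre (`stub_fsigma_meagre`). [folklore] -/
theorem isMeagre_loudSteadyLeaf_diff_interior (S : Finset (Fin 3 → ℤ)) (a E ε : ℝ) :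
    IsMeagre (loudSteadyLeaf S a E ε \ interior (loudSteadyLeaf S a E ε)) := by
  rw [loudSteadyLeaf_eq_iUnion]
  exact stub_fsigma_meagre (steadyStratum S a E ε) (isClosed_steadyStratum S a E ε)

/-- **THE STEADY LEAF OF THE UPGRADE FAILS AT MOST ON A MEAGRE SET.**  For every frequency set `S`, ceiling `a` and budgets
`E, ε`, the mean-zero steady-loud forces that are not INTERIOR points of `loud S a E ε` (the SAME budgets; no stock of perturbation
modes) form a meagre subset of `P_S`. [folklore] -/
theorem isMeagre_loudSteadyLeaf_diff_interior_loud (S : Finset (Fin 3 → ℤ)) (a E ε : ℝ) :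
    IsMeagre (loudSteadyLeaf S a E ε \ interior (loud S a E ε)) :=
  (isMeagre_loudSteadyLeaf_diff_interior S a E ε).mono fun _ hx =>
    (show _ ∈ _ \ _ from ⟨hx.1, fun h => hx.2 (interior_mono (loudSteadyLeaf_subset_loud S a E ε) h)⟩)

/-- **Corollary in the crux's shape.**  For `0 ≤ E`, `0 ≤ ε` the mean-zero steady-loud forces of `LOUD^{(0,a)}(S,E,ε)` outside
`closure (interior LOUD^{(0,a)}(S,2E,ε/2))` — the mean-zero steady leaf of the wild residual of the crux — form a MEAGRE set, for every
`S` (no stock) and every ceiling `a`. [folklore] -/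
theorem isMeagre_steadyLeaf_residual (S : Finset (Fin 3 → ℤ)) (a E ε : ℝ) (hE : 0 ≤ E) (hε : 0 ≤ ε) :
    IsMeagre (loudSteadyLeaf S a E ε \ closure (interior (loud S a (2 * E) (ε / 2)))) := by
  refine (isMeagre_loudSteadyLeaf_diff_interior_loud S a E ε).mono fun _ hx =>
    (show _ ∈ _ \ _ from ⟨hx.1, fun h => hx.2 ?_⟩)
  exact (interior_mono (loud_mono (by linarith) (by linarith))).trans subset_closure h

/-- The same at every level `j` of the route (ceiling `a = 1/(j+1)`), quantified as in the crux: for EVERY stock-free `S`, all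
budgets with `0 < ε` and every level, the mean-zero steady part of `LOUD_j(S,E,ε) ∖ closure (interior LOUD_j(S,2E,ε/2))` is meagre.
(`0 ≤ E` is automatic: a witness with `meanEnergy ≤ E < 0` does not exist, so the set is empty otherwise.) [folklore] -/
theorem isMeagre_steadyLeaf_residual_level (S : Finset (Fin 3 → ℤ)) (E ε : ℝ) (hε : 0 < ε) (j : ℕ) :
    IsMeagre (loudSteadyLeaf S (1 / ((j : ℝ) + 1)) E ε \
      closure (interior (loud S (1 / ((j : ℝ) + 1)) (2 * E) (ε / 2)))) := by
  rcases le_or_gt 0 E with hE | hE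
  · exact isMeagre_steadyLeaf_residual S _ E ε hE hε.le
  · -- negative energy budget: no witness at all
    have hempty : loudSteadyLeaf S (1 / ((j : ℝ) + 1)) E ε = ∅ := by
      ext c
      simp only [mem_empty_iff_false, iff_false]
      rintro ⟨ν, -, -, u, p, -, -, hEu, -⟩
      have h0 : 0 ≤ meanEnergy (fun _ : ℝ => u) := by
        rw [meanEnergy_eq_of_periodic (τ := 1) (fun _ => rfl) one_pos]
        exact mul_nonneg (by norm_num) (intervalIntegral.integral_nonneg zero_le_one fun t _ =>
          integral_nonneg fun x => by positivity)
      linarith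
    rw [hempty, empty_sdiff]
    exact IsMeagre.empty

/-- **Registered sub-goal `steadyLeaf_residual_isMeagre` (lead c15)** — the level form with the leaf written out (definitionally
`isMeagre_steadyLeaf_residual_level`): for every `S` (no stock), all budgets with `0 < ε` and every level `j`, the coefficient vectors
carrying a mean-zero classical steady loud witness of `LOUD_j(S,E,ε)` that lie outside `closure (interior LOUD_j(S,2E,ε/2))` form a
MEAGRE subset of `P_S`. [folklore] -/
theorem steadyLeaf_residual_isMeagre : ∀ (S : Finset (Fin 3 → ℤ)) (E ε : ℝ), 0 < ε → ∀ j : ℕ,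
    IsMeagre ({c : Coeff S | ∃ ν : ℝ, 0 < ν ∧ ν < 1 / ((j : ℝ) + 1) ∧
      ∃ (u : UnitAddTorus (Fin 3) → EuclideanSpace ℝ (Fin 3)) (p : UnitAddTorus (Fin 3) → ℝ),
        Torus.IsSteadyNSState ν (force S c) u p ∧ HasZeroMean u ∧
          meanEnergy (fun _ : ℝ => u) ≤ E ∧ ε ≤ meanDissipation ν (fun _ : ℝ => u)} \
      closure (interior (loud S (1 / ((j : ℝ) + 1)) (2 * E) (ε / 2)))) :=
  fun S E ε hε j => isMeagre_steadyLeaf_residual_level S E ε hε j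

/-! ## §3 The dichotomy near any force, and a route-level door -/

/-- **Dichotomy.**  In every open set `V` of forces: either `V` contains ROBUSTLY loud forces (interior points of `loud S a E ε`),
or the mean-zero steady-loud forces of `V` form a meagre set.  (There is no "dense but nowhere robust" steady loudness other than
meagre loudness.) [folklore] -/
theorem interior_loud_nonempty_or_isMeagre (S : Finset (Fin 3 → ℤ)) (a E ε : ℝ) (V : Set (Coeff S)) :
    (interior (loud S a E ε) ∩ V).Nonempty ∨ IsMeagre (loudSteadyLeaf S a E ε ∩ V) := by
  by_cases h : (interior (loud S a E ε) ∩ V).Nonempty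
  · exact Or.inl h
  · refine Or.inr ((isMeagre_loudSteadyLeaf_diff_interior_loud S a E ε).mono fun c hc => ?_)
    refine (show _ ∈ _ \ _ from ⟨hc.1, fun hi => h ⟨c, hi, hc.2⟩⟩)

/-- **Route-level door (no upgrade crux): `BaireTarget` from LOCALLY NON-MEAGRE mean-zero steady loudness.**  If for some `S`,
budgets `E`, `ε > 0` and a non-empty open `U ⊆ P_S`, at every level `j` and in every non-empty open `V ⊆ U` the mean-zero
steady-loud forces `loudSteadyLeaf S (1/(j+1)) E ε ∩ V` are NOT meagre, then the route target `BaireTarget` holds (with the same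
`S, E, ε, U`): by the dichotomy every such `V` meets `interior LOUD_j`, i.e. the robustly loud forces are dense in `U`.  Compare
`WildResidual.baireTarget_of_dense_tame` (density of TAME-loud forces); here no tameness certificate is asked of the witnesses, only
that loudness is not confined to a meagre set. [folklore] -/
theorem baireTarget_of_nonmeagre_steadyLeaf
    (h : ∃ (S : Finset (Fin 3 → ℤ)) (E ε : ℝ), 0 < ε ∧ ∃ U : Set (Coeff S), IsOpen U ∧ U.Nonempty ∧
      ∀ j : ℕ, ∀ V : Set (Coeff S), IsOpen V → V.Nonempty → V ⊆ U →
        ¬ IsMeagre (loudSteadyLeaf S (1 / ((j : ℝ) + 1)) E ε ∩ V)) :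
    BaireTarget := by
  obtain ⟨S, E, ε, hε, U, hU, hUne, hbig⟩ := h
  refine ⟨S, E, ε, hε, U, hU, hUne, fun j c hcU => ?_⟩
  -- every neighbourhood of `c ∈ U` meets `interior LOUD_j`
  rw [mem_closure_iff_nhds]
  intro t ht
  obtain ⟨V, hVt, hV, hcV⟩ := mem_nhds_iff.1 ht
  have hW : IsOpen (V ∩ U) := hV.inter hU
  rcases interior_loud_nonempty_or_isMeagre S (1 / ((j : ℝ) + 1)) E ε (V ∩ U) with ⟨x, hx, hxV, -⟩ | hm
  · exact ⟨x, hVt hxV, hx⟩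
  · exact absurd hm (hbig j (V ∩ U) hW ⟨c, hcV, hcU⟩ inter_subset_right)

end Summit.AnomalousDissipation.AnomalousDissipation.Theorems.RobustLoudUpgrade.Category

end
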